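import Summits.CriticalPhenomena.CardyFormulaZ2.Theorems.CardyBoundaryCoulombGasStripClusterRatesBandLimitKac

/-!
# Stub `arm_nMul_rateTwo_limit_ge_pi` of line `two-cluster-rate-is-stationary-gap`
# (crux `CardyBoundaryCoulombGas.StripClusterRates`, stmt-CriticalPhenomena-13878)

**ARM LIMIT VS. KAC.** The BK–Reimer three-arm bound of the lead gives
`γ₂(n) ≥ 2 γ₁(n) + γ₁(n-1)` for `n ≥ 2` (hypothesis `hineq`, supplied by the neighbouring stubs).
Under the `γ₁`-half of the crux, `n · γ₁(n) → π/3`, every limit `L₂` of `n · γ₂(n)` therefore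
satisfies `π ≤ L₂` — consistent with the crux's claim `L₂ = 2π > π`.

Proof (pure real analysis): for `n ≥ 2`,
`n · γ₂(n) ≥ 2 · (n γ₁ n) + (n-1) γ₁(n-1) + γ₁(n-1)`, and `n γ₁ n → π/3`,
`(n-1) γ₁(n-1) → π/3` (shift by one), `γ₁(n-1) → 0` (`band_tendsto_zero_of_nMul_tendsto`, shifted),
so the right side tends to `2π/3 + π/3 + 0 = π`; conclude with `le_of_tendsto_of_tendsto`.
-/

noncomputable section

open MeasureTheory Filter Topology
open Literature.Probability.LatticeModels Literature.Probability.Percolation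

namespace Summit.CriticalPhenomena.CardyFormulaZ2.Cruxes.StripClusterRates.TwoClusterRateIsStationaryGap

/-- **`arm_nMul_rateTwo_limit_ge_pi`.** If `2 γ₁(n) + γ₁(n-1) ≤ γ₂(n)` for all `n ≥ 2`
(the BK–Reimer three-arm bound) and `n · γ₁(n) → π/3` (the `γ₁`-half of the crux), then every
limit `L₂` of `n · γ₂(n)` satisfies `π ≤ L₂`:
`n γ₂ n ≥ 2 (n γ₁ n) + (n-1) γ₁(n-1) + γ₁(n-1) → 2π/3 + π/3 + 0 = π`. [folklore] -/
theorem arm_nMul_rateTwo_limit_ge_pi : ∀ γ₁ γ₂ : ℕ → ℝ, (∀ n : ℕ, 2 ≤ n → 2 * γ₁ n + γ₁ (n - 1) ≤ γ₂ n) → Tendsto (fun n : ℕ ↦ (n : ℝ) * γ₁ n) atTop (𝓝 (Real.pi / 3)) → ∀ L₂ : ℝ, Tendsto (fun n : ℕ ↦ (n : ℝ) * γ₂ n) atTop (𝓝 L₂) → Real.pi ≤ L₂ := by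
  intro γ₁ γ₂ hineq hγ₁ L₂ hL
  -- `γ₁ n → 0`
  have hγ₁0 : Tendsto γ₁ atTop (𝓝 0) := band_tendsto_zero_of_nMul_tendsto hγ₁
  -- the shift `n ↦ n - 1`
  have hsub : Tendsto (fun n : ℕ ↦ n - 1) atTop atTop := tendsto_sub_atTop_nat 1
  have h1 : Tendsto (fun n : ℕ ↦ ((n - 1 : ℕ) : ℝ) * γ₁ (n - 1)) atTop (𝓝 (Real.pi / 3)) :=
    hγ₁.comp hsub
  have h2 : Tendsto (fun n : ℕ ↦ γ₁ (n - 1)) atTop (𝓝 0) := hγ₁0.comp hsub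
  -- the right side `n · (2 γ₁ n + γ₁ (n-1)) = 2 (n γ₁ n) + (n-1) γ₁ (n-1) + γ₁ (n-1) → π`
  have hR : Tendsto (fun n : ℕ ↦ (n : ℝ) * (2 * γ₁ n + γ₁ (n - 1))) atTop (𝓝 Real.pi) := by
    have h3 : Tendsto (fun n : ℕ ↦ 2 * ((n : ℝ) * γ₁ n) + ((n - 1 : ℕ) : ℝ) * γ₁ (n - 1)
        + γ₁ (n - 1)) atTop (𝓝 (2 * (Real.pi / 3) + Real.pi / 3 + 0)) :=
      ((hγ₁.const_mul 2).add h1).add h2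
    have h4 : 2 * (Real.pi / 3) + Real.pi / 3 + (0 : ℝ) = Real.pi := by ring
    rw [h4] at h3
    refine h3.congr' ?_
    filter_upwards [eventually_ge_atTop 1] with n hn
    rw [Nat.cast_sub hn, Nat.cast_one]
    ring
  refine le_of_tendsto_of_tendsto hR hL ?_
  filter_upwards [eventually_ge_atTop 2] with n hn
  exact mul_le_mul_of_nonneg_left (hineq n hn) (Nat.cast_nonneg n)

end Summit.CriticalPhenomena.CardyFormulaZ2.Cruxes.StripClusterRates.TwoClusterRateIsStationaryGap

end
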